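import Literature.Barriers.CriticalPhenomena.PlaquetteWalkYBCoefficientRigidity
import Literature.Probability.RandomPlanarGeometry.YangBaxterSAWHexBridges
import HarnessLib

/-!
# Barrier catalogue (SAWScalingLimit): the Yang–Baxter vertex identity FAILS at a hole root —
an explicit, kernel-certified defect

Companion of `Literature.Probability.RandomPlanarGeometry.YangBaxterSAWGeneralDomain` (Glazman–
Manolescu's Lemma 2.1 on EVERY finite face list for every OUTER root: a root from which an exterior
king-chain reaches infinity) and of `PlaquetteWalkYBClassification` (the necessity chain re-run from the
ROW-CONVEX class, because the all-boundary-roots class `ExactPlaquetteVertexRelation` of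
`PlaquetteWalkSpinRigidity` is not satisfied by the printed weights). This file makes the second
remark a theorem: on the `3 × 3` block of faces minus its centre, rooted on the boundary of the HOLE
(the `N` side of the missing centre), the printed Yang–Baxter weights at `θ = π/3`
(`(u₁, u₂, v, w₁, w₂) = (x_c, x_c², x_c², x_c², 0)`, `x_c = 1/√(2+√2)`) with the Yang–Baxter
coefficients `(1, r, −1, −r)`, `r = e^{7iπ/16}`, violate the vertex relation at the root plaquette:

* `vertexFunctional_ring8_mul` — for ARBITRARY weights `W`, phase `t ≠ 0` and coefficients `c`, the
  functional at the root plaquette of the ring, times `t⁵`, is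
  `(c_S t + c_W u₂ t² + c_E u₁ + c_N v t)·t⁴ + u₁²u₂²v³·(c_E u₂ t¹⁰ + c_N w₂ t⁹ + c_W u₁ + c_N w₁ t)`:
  the one-plaquette ("group one") form plus the contribution of the two walks that go once AROUND
  THE HOLE and re-enter the root plaquette (kernel enumeration: eight walks end on a side of the root
  plaquette);
* `vertexFunctional_printed_ring8` — for the printed weights at `θ = π/3` the group-one form vanishes
  and the loop term is `−2 x_c¹⁴ y²`, `y = e^{−iπ/16}`: the functional equals `−2 x_c¹⁴ y² t⁻⁵ ≠ 0`
  (`vertexFunctional_printed_ring8_ne_zero`);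
* hence **`not_exactPlaquetteVertexRelation_printed_pi_div_three`**: the all-boundary-roots class
  `ExactPlaquetteVertexRelation (printedWeights (π/3)) t (ybCoeff (π/3))` is FALSE (so the all-roots
  necessity theorems of `PlaquetteWalkSpinRigidity` / `PlaquetteWalkWeightRigidityPrinted` are
  vacuous on the Yang–Baxter family — the row-convex re-run of `PlaquetteWalkYBClassification` is the
  contentful one), the named statement `PlaquetteWalkHoleRootDefect` / `_holds`, and — read through
  Lemma 2.1 for outer roots — the purely combinatorial `not_outerRoot_holeRoot`: the hole root is not
  an outer root (no exterior king-chain leaves the hole), proved here through the observable.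

* ★ **`not_exactPlaquetteVertexRelation_of_ne_zero`** / named `PlaquetteWalkNoAllRootsRelation(_holds)` —
  the ALL-BOUNDARY-ROOTS CLASS IS EMPTY on the whole five-weight family with `u₁u₂v ≠ 0`: for every such
  `W`, every `t ≠ 0` and every `c ≠ 0`, `¬ ExactPlaquetteVertexRelation W t c`. Proof: such a relation
  forces (tree: spin, weight and coefficient rigidity from the row-convex sub-class) `t¹⁶ = −1`,
  `W = ybCurve ε t r`, `c = c_E·(1, r, ε, εr)`; the ring instance minus `t⁴`× the one-plaquette instance
  leaves the LOOP FORM `c_E u₂ t¹⁰ + c_N (w₂ t⁹ + w₁ t) + c_W u₁ = 0` (`loopForm_of_exactPlaquetteVertexRelation`),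
  and on the curve the loop form is `2 c_E r t⁵ v_{(−1)}` (`loopForm_ybCurve`, a rational-function
  identity) — nonzero. So exact vertex identities on `ℤ²` exist (the sixteen curves, outer roots:
  `PlaquetteWalkYBCurveIdentityAllSpins`) but NONE survives hole roots: the hole defect of the ring is
  `F = 2 c_E r u₁² u₂² v³ v_{(−1)} ≠ 0` at EVERY point of every curve.

On the way: the printed weights at `θ = π/3` in closed form, `printedWeights_pi_div_three`, assembled
from the tree's `weightU1/U2/V/W1/W2_pi_div_three` (`YangBaxterSAW`, `YangBaxterSAWHexBridges`).

Sources. A. Glazman, I. Manolescu, arXiv:1708.00395: eq. (1) and "if θ = π/3, then w₂ = 0 …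
u₁ = x_c" (§1, Fig. 2) [cite: GlazmanManolescu2019, §1, eq. (1) and Fig. 2]; Lemma 2.1 (the relation
at each rhombus of a simply connected domain, walks from an outer boundary point)
[cite: GlazmanManolescu2019, Lemma 2.1]; the general-domain quantifier of the vertex relation
[cite: DuminilCopinSmirnov2012, Lemma 1]. The failure at hole roots is implicit in print (the
proofs of Lemma 2.1 / DCS Lemma 1 use that the winding of a walk from the OUTER boundary to a given
mid-edge is determined; around a hole it is not) and was observed numerically in the venture lane
(HOME/pub-sawmu-b-engine-1/g9/holecheck: 34 nonzero hole-rooted rows, all outer-rooted rows zero);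
the explicit value `−2x_c¹⁴ y² t⁻⁵` on the ring and its kernel certificate are this file's.
Status in print: the vertex relation is printed under the hypothesis "Ω simply connected, a ∈ ∂Ω"
([cite: DuminilCopinSmirnov2012, §2 and proof of Lemma 1 (arXiv p. 4)];
[cite: GlazmanManolescu2019, Lemma 2.1 (arXiv v3 pp. 6–7)]); this file certifies an explicit hole-root
configuration where the relation fails, i.e. the hypothesis is necessary — CONSOLIDATION (negative
datum), consistent with the lane's defect identity `vertexFunctional_printed_isthmus_root` of
`PlaquetteWalkIsthmusRoot` (label cell of record lit-2 g16, 2026-08-23); not located in print as a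
worked example.

Implementation note: the row identity `vertexFunctional · t^{m₀} = rowSumN …` is the private lemma
`vertexFunctional_mul_pow_eq_rowSumN` of `PlaquetteWalkSpinRigidity`, read here via
`open private … from` (as in `PlaquetteWalkYBCurveIdentity`); the term list of the ring is certified
by `decide` against the tree's `YBWalk` enumeration.

Written for the venture lane «pcv-sawmu» (Tier B; b-engine-1 gen 11, successor door (iv) of gen 10; the
capstone `PlaquetteWalkNoAllRootsRelation` uses the tree's `pair_rigidity` of `PlaquetteWalkYBCoefficientRigidity`).
-/

noncomputable section

namespace Literature.Barriers.CriticalPhenomena.PlaquetteWalk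

open Literature.Probability.RandomPlanarGeometry.SAW
open Literature.Probability.RandomPlanarGeometry.SAW.YangBaxter Real Complex

open private vertexFunctional_mul_pow_eq_rowSumN from Literature.Barriers.CriticalPhenomena.PlaquetteWalkSpinRigidity

/-! ### The ring domain and its hole root -/

/-- The `3 × 3` block of faces minus its centre `(1, 1)` — the smallest face list with a hole
(a complementary face from which no king-chain reaches infinity). [folklore] -/
def ring8 : List Face := [(0, 0), (1, 0), (2, 0), (0, 1), (2, 1), (0, 2), (1, 2), (2, 2)]

/-- The hole root: the `N` side of the missing centre `(1, 1)` (= the `S` side of the root plaquette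
`(1, 2)`). [folklore] -/
def holeRoot : MidEdge := Face.side (1, 1) .N

/-- The hole root IS a boundary root of the ring (exactly one of its two faces is in the list).
[cite: GlazmanManolescu2019, §2.1 (walks start on the boundary)] -/
theorem isBoundaryRoot_holeRoot : IsBoundaryRoot ring8 holeRoot := by
  decide

/-- The root plaquette `(1, 2)` is a face of the ring. [folklore] -/
private theorem rootFace_mem_ring8 : ((1 : ℤ), (2 : ℤ)) ∈ ring8 := by
  decide

/-- **Kernel enumeration**: the eight walks of the ring from the hole root that end on a side of the
root plaquette `(1, 2)` — the trivial walk, the three one-arc walks, and four walks around the hole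
(two ending on the far sides `E`/`W` of `(1, 2)` from outside, two re-entering `(1, 2)` and leaving
through `N`) — as cleared terms (slot, `n_{u₁}, n_{u₂}, n_v, n_{w₁}, n_{w₂}`, `q + 5`). [folklore] -/
private theorem termsN_ring8 :
    termsN ring8 holeRoot (1, 2) (depth ring8) 5 =
      [⟨3, 0, 0, 0, 0, 0, 5⟩, ⟨2, 0, 1, 0, 0, 0, 6⟩, ⟨0, 2, 3, 3, 0, 0, 10⟩, ⟨1, 2, 2, 3, 0, 1, 9⟩,
       ⟨1, 0, 0, 1, 0, 0, 5⟩, ⟨0, 1, 0, 0, 0, 0, 4⟩, ⟨2, 3, 2, 3, 0, 0, 0⟩, ⟨1, 2, 2, 3, 1, 0, 1⟩] := by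
  decide

/-- **The vertex functional at the root plaquette of a hole root, for arbitrary weights**:
`F·t⁵ = (c_S t + c_W u₂ t² + c_E u₁ + c_N v t)·t⁴ + u₁²u₂²v³·(c_E u₂ t¹⁰ + c_N w₂ t⁹ + c_W u₁ + c_N w₁ t)`
— the one-plaquette form plus the two loops around the hole. [cite: GlazmanManolescu2019, §2.1, eq. (2.1)]
[cite: DuminilCopinSmirnov2012, Lemma 1 (shape of the relation)] -/
theorem vertexFunctional_ring8_mul (W : CWeights) {t : ℂ} (ht : t ≠ 0) (c : Fin 4 → ℂ) :
    vertexFunctional W t c ring8 holeRoot (1, 2) * t ^ 5 =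
      (c 3 * t + c 2 * W.u₂ * t ^ 2 + c 0 * W.u₁ + c 1 * W.v * t) * t ^ 4 +
      W.u₁ ^ 2 * W.u₂ ^ 2 * W.v ^ 3 *
        (c 0 * W.u₂ * t ^ 10 + c 1 * W.w₂ * t ^ 9 + c 2 * W.u₁ + c 1 * W.w₁ * t) := by
  have hrow := vertexFunctional_mul_pow_eq_rowSumN W ht c ring8 holeRoot (1, 2) 5 (by decide)
  rw [termsN_ring8] at hrow
  rw [hrow]
  simp only [rowSumN, List.map_cons, List.map_nil, List.sum_cons, List.sum_nil, CWeights.mono, pow_zero,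
    pow_one, mul_one, one_mul]
  ring

/-! ### The printed weights at `θ = π/3` in closed form -/

/-- **The printed weights at `θ = π/3`**: `(u₁, u₂, v, w₁, w₂) = (x_c, x_c², x_c², x_c², 0)` (the tree's
five evaluations `weightU1/U2/V/W1/W2_pi_div_three`, assembled).
[cite: GlazmanManolescu2019, §1, Fig. 2 ("if θ = π/3, then w₂ = 0 … u₁ = x_c")] -/
theorem printedWeights_pi_div_three : printedWeights (π / 3) =
    ⟨(hexCriticalFugacity : ℂ), (hexCriticalFugacity : ℂ) ^ 2, (hexCriticalFugacity : ℂ) ^ 2,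
      (hexCriticalFugacity : ℂ) ^ 2, 0⟩ := by
  rw [printedWeights, weightU1_pi_div_three, weightU2_pi_div_three, weightV_pi_div_three,
    weightW1_pi_div_three, weightW2_pi_div_three]
  push_cast
  rfl

/-! ### The phases at `θ = π/3` in the variable `y = e^{−iπ/16}` -/

/-- `y ≠ 0`. [folklore] -/
private theorem uY_ne_zero' : uY ≠ 0 := Complex.exp_ne_zero _

/-- `y¹⁶ = e^{−iπ} = −1`. [folklore] -/
private theorem uY_pow_sixteen' : uY ^ 16 = -1 := by
  rw [uY, ← Complex.exp_nat_mul]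
  push_cast
  rw [show (16 : ℂ) * -((π : ℂ) / 16 * I) = -((π : ℂ) * I) by ring, Complex.exp_neg, Complex.exp_pi_mul_I]
  norm_num

/-- `t = e^{−5iπ/16} = y⁵`. [cite: GlazmanManolescu2019, §2.1, eq. (2.1) (σ = 5/8)] -/
private theorem tFiveEighths_eq_uY_pow : tFiveEighths = uY ^ 5 := by
  rw [tFiveEighths, uY, ← Complex.exp_nat_mul]; congr 1; push_cast; ring

/-- `r(π/3) = e^{7iπ/16} = y⁻⁷`: `r(π/3) · y⁷ = 1`. [cite: GlazmanManolescu2019, Lemma 2.1, eq. (CR)] -/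
private theorem ybRatio_pi_div_three_mul : ybRatio (π / 3) * uY ^ 7 = 1 := by
  rw [ybRatio, uY, ← Complex.exp_nat_mul, ← Complex.exp_add,
    show (3 * (π / 3) / 8 + 5 * π / 16 : ℝ) = 7 * π / 16 by ring]
  convert Complex.exp_zero using 2
  push_cast
  ring

/-- `r(π/3) = −y⁹` (from `r y⁷ = 1` and `y¹⁶ = −1`). [folklore] -/
private theorem ybRatio_pi_div_three_eq : ybRatio (π / 3) = -uY ^ 9 := by
  have h1 : uY ^ 7 * (-uY ^ 9) = 1 := by linear_combination (-1 : ℂ) * uY_pow_sixteen'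
  calc ybRatio (π / 3) = ybRatio (π / 3) * (uY ^ 7 * (-uY ^ 9)) := by rw [h1, mul_one]
    _ = ybRatio (π / 3) * uY ^ 7 * (-uY ^ 9) := by ring
    _ = -uY ^ 9 := by rw [ybRatio_pi_div_three_mul, one_mul]

/-- `y² + y⁻² = 2cos(π/8) = √(2+√2)`. [folklore] -/
private theorem uY_sq_add_inv : uY ^ 2 + (uY ^ 2)⁻¹ = (Real.sqrt (2 + Real.sqrt 2) : ℂ) := by
  have hsq : uY ^ 2 = Complex.exp (-((π : ℂ) / 8) * I) := by
    rw [uY, ← Complex.exp_nat_mul]; congr 1; push_cast; ring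
  have hinv : (uY ^ 2)⁻¹ = Complex.exp (((π : ℂ) / 8) * I) := by
    rw [hsq, ← Complex.exp_neg]; congr 1; ring
  have hcos : Complex.cos ((π : ℂ) / 8) = (Real.cos (π / 8) : ℂ) := by
    rw [Complex.ofReal_cos]; push_cast; ring_nf
  rw [hinv, hsq, add_comm, ← Complex.two_cos, hcos, Real.cos_pi_div_eight]
  push_cast
  ring

/-- `x_c · (y² + y⁻²) = 1`, i.e. `x_c = 1/(2cos(π/8))`. [cite: DuminilCopinSmirnov2012, §1 (x_c = 1/√(2+√2))] -/
private theorem hexCriticalFugacity_mul_uY : (hexCriticalFugacity : ℂ) * (uY ^ 2 + (uY ^ 2)⁻¹) = 1 := by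
  rw [uY_sq_add_inv, hexCriticalFugacity]
  have h : (Real.sqrt (2 + Real.sqrt 2) : ℂ) ≠ 0 :=
    Complex.ofReal_ne_zero.2 (Real.sqrt_pos.2 (by positivity)).ne'
  push_cast
  exact inv_mul_cancel₀ h

/-- `2 x_c = y² − y⁶ + y¹⁰ − y¹⁴` (the inverse of `1 + y⁴` modulo `y¹⁶ + 1`). [folklore] -/
private theorem two_mul_hexCriticalFugacity :
    2 * (hexCriticalFugacity : ℂ) = uY ^ 2 - uY ^ 6 + uY ^ 10 - uY ^ 14 := by
  have hy := uY_ne_zero'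
  have hx' : (hexCriticalFugacity : ℂ) * (uY ^ 4 + 1) = uY ^ 2 := by
    have h := hexCriticalFugacity_mul_uY
    have hy2 : uY ^ 2 ≠ 0 := pow_ne_zero 2 hy
    calc (hexCriticalFugacity : ℂ) * (uY ^ 4 + 1)
        = (hexCriticalFugacity : ℂ) * (uY ^ 2 + (uY ^ 2)⁻¹) * uY ^ 2 := by field_simp
      _ = uY ^ 2 := by rw [h, one_mul]
  linear_combination (1 - uY ^ 4 + uY ^ 8 - uY ^ 12) * hx' + (hexCriticalFugacity : ℂ) * uY_pow_sixteen'

/-! ### The defect at the root plaquette -/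

/-- **The printed weights at `θ = π/3` violate the vertex relation at the root plaquette of the hole
root**: `F · t⁵ = −2 x_c¹⁴ y²` (the group-one form vanishes; the two loops around the hole contribute
`x_c¹³(x_c t¹⁰ − 1 + r x_c t) = −2x_c¹⁴y²`). [cite: GlazmanManolescu2019, eq. (1), Lemma 2.1] -/
theorem vertexFunctional_printed_ring8 :
    vertexFunctional (printedWeights (π / 3)) tFiveEighths (ybCoeff (π / 3)) ring8 holeRoot (1, 2) *
        tFiveEighths ^ 5 = -2 * (hexCriticalFugacity : ℂ) ^ 14 * uY ^ 2 := by
  rw [vertexFunctional_ring8_mul _ tFiveEighths_ne_zero, printedWeights_pi_div_three, ← oddCoeff_ybRatio,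
    tFiveEighths_eq_uY_pow, ybRatio_pi_div_three_eq]
  have c0 : oddCoeff (-uY ^ 9) 0 = 1 := rfl
  have c1 : oddCoeff (-uY ^ 9) 1 = -uY ^ 9 := rfl
  have c2 : oddCoeff (-uY ^ 9) 2 = -1 := rfl
  have c3 : oddCoeff (-uY ^ 9) 3 = -(-uY ^ 9) := rfl
  simp only [c0, c1, c2, c3]
  have h16 := uY_pow_sixteen'
  have hx2 := two_mul_hexCriticalFugacity
  set x : ℂ := (hexCriticalFugacity : ℂ) with hxdef
  set y : ℂ := uY with hydef
  -- the one-plaquette (group-one) form vanishes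
  have hL : -(-y ^ 9) * y ^ 5 + (-1) * x ^ 2 * (y ^ 5) ^ 2 + 1 * x + (-y ^ 9) * x ^ 2 * y ^ 5 = 0 := by
    linear_combination (((1 : ℂ) / 2) + ((-1 : ℂ) / 4) * y ^ 12 + ((1 : ℂ) / 4) * y ^ 28 +
      ((-1 : ℂ) / 2) * x * y ^ 10 + ((-1 : ℂ) / 2) * x * y ^ 14) * hx2 +
      (((1 : ℂ) / 2) * y ^ 2 + ((-1 : ℂ) / 2) * y ^ 6 + ((1 : ℂ) / 2) * y ^ 10 + ((1 : ℂ) / 4) * y ^ 14 +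
      ((-1 : ℂ) / 4) * y ^ 18 + ((1 : ℂ) / 4) * y ^ 22 + ((-1 : ℂ) / 4) * y ^ 26) * h16
  -- the loop term
  have hI : x * (y ^ 5) ^ 10 - 1 + (-y ^ 9) * x * y ^ 5 = -2 * x * y ^ 2 := by
    linear_combination ((1 : ℂ) * y ^ 2 + ((-1 : ℂ) / 2) * y ^ 14 + ((1 : ℂ) / 2) * y ^ 50) * hx2 +
      ((-1 : ℂ) + (1 : ℂ) * y ^ 4 + (-1 : ℂ) * y ^ 8 + (1 : ℂ) * y ^ 12 + ((-1 : ℂ) / 2) * y ^ 16 +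
      ((-1 : ℂ) / 2) * y ^ 20 + ((1 : ℂ) / 2) * y ^ 24 + ((-1 : ℂ) / 2) * y ^ 28 + ((1 : ℂ) / 2) * y ^ 32 +
      ((1 : ℂ) / 2) * y ^ 36 + ((-1 : ℂ) / 2) * y ^ 40 + ((1 : ℂ) / 2) * y ^ 44 + ((-1 : ℂ) / 2) * y ^ 48) * h16
  linear_combination (y ^ 5) ^ 4 * hL + x ^ 13 * hI

/-- **The defect is nonzero.** [cite: GlazmanManolescu2019, Lemma 2.1 (outer boundary point)] -/
theorem vertexFunctional_printed_ring8_ne_zero :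
    vertexFunctional (printedWeights (π / 3)) tFiveEighths (ybCoeff (π / 3)) ring8 holeRoot (1, 2) ≠ 0 := by
  intro h
  have key := vertexFunctional_printed_ring8
  rw [h, zero_mul] at key
  have hx : (hexCriticalFugacity : ℂ) ≠ 0 := Complex.ofReal_ne_zero.2 hexCriticalFugacity_pos_lt_one.1.ne'
  exact (mul_ne_zero (mul_ne_zero (by norm_num) (pow_ne_zero 14 hx)) (pow_ne_zero 2 uY_ne_zero')) key.symm

/-- **The all-boundary-roots class is violated by the printed Yang–Baxter weights**: at `θ = π/3`,
`ExactPlaquetteVertexRelation (W(θ)) t (1, r(θ), −1, −r(θ))` is false — the relation fails at the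
root plaquette of a hole root. (So the necessity theorems stated for the all-roots class are vacuous
on the Yang–Baxter family; the row-convex class of `PlaquetteWalkYBClassification` is the contentful
frame.) [cite: GlazmanManolescu2019, Lemma 2.1 (walks from an OUTER boundary point)] -/
theorem not_exactPlaquetteVertexRelation_printed_pi_div_three :
    ¬ ExactPlaquetteVertexRelation (printedWeights (π / 3)) tFiveEighths (ybCoeff (π / 3)) :=
  fun h => vertexFunctional_printed_ring8_ne_zero (h ring8 holeRoot (1, 2) rootFace_mem_ring8 isBoundaryRoot_holeRoot)

/-- **The hole root is not an outer root** (no exterior king-chain leaves the hole of the ring) —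
a combinatorial fact, obtained here through the observable: at an outer root the functional would
vanish by Lemma 2.1 on general domains (`vertexFunctional_printed_eq_zero`). [cite: GlazmanManolescu2019, Lemma 2.1] -/
theorem not_outerRoot_holeRoot : ¬ OuterRoot (dom ring8) holeRoot := fun hO =>
  vertexFunctional_printed_ring8_ne_zero
    (vertexFunctional_printed_eq_zero (θ := π / 3) ⟨le_rfl, by linarith [Real.pi_pos]⟩ ring8 holeRoot hO
      (1, 2) rootFace_mem_ring8)

/-! ### No weight system with `u₁u₂v ≠ 0` satisfies the relation for ALL boundary roots -/

/-- Kernel enumeration, one plaquette: the four walks of the single face `(1, 2)` from its `S` side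
(= the hole root). [folklore] -/
private theorem termsN_rootFace :
    termsN [((1 : ℤ), (2 : ℤ))] holeRoot (1, 2) (depth [((1 : ℤ), (2 : ℤ))]) 1 =
      [⟨3, 0, 0, 0, 0, 0, 1⟩, ⟨2, 0, 1, 0, 0, 0, 2⟩, ⟨0, 1, 0, 0, 0, 0, 0⟩, ⟨1, 0, 0, 1, 0, 0, 1⟩] := by
  decide

/-- The one-plaquette ("group one") instance at the root plaquette: `F_{[(1,2)]}·t = c_S t + c_W u₂ t² + c_E u₁ + c_N v t`.
[cite: Glazman2015WeightedSAW, Lemma 3.1 (the local linear system)] -/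
theorem vertexFunctional_rootFace_mul (W : CWeights) {t : ℂ} (ht : t ≠ 0) (c : Fin 4 → ℂ) :
    vertexFunctional W t c [((1 : ℤ), (2 : ℤ))] holeRoot (1, 2) * t =
      c 3 * t + c 2 * W.u₂ * t ^ 2 + c 0 * W.u₁ + c 1 * W.v * t := by
  have hrow := vertexFunctional_mul_pow_eq_rowSumN W ht c [((1 : ℤ), (2 : ℤ))] holeRoot (1, 2) 1 (by decide)
  rw [termsN_rootFace, pow_one] at hrow
  rw [hrow]
  simp only [rowSumN, List.map_cons, List.map_nil, List.sum_cons, List.sum_nil, CWeights.mono, pow_zero,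
    pow_one, mul_one, one_mul]
  ring

/-- **The loop form of an all-roots relation**: if the relation holds for all boundary roots of all face
lists (`u₁u₂v ≠ 0`), then `c_E u₂ t¹⁰ + c_N w₂ t⁹ + c_W u₁ + c_N w₁ t = 0` (the ring instance minus `t⁴`
times the one-plaquette instance, divided by `u₁²u₂²v³`). [cite: GlazmanManolescu2019, Lemma 2.1] -/
theorem loopForm_of_exactPlaquetteVertexRelation {W : CWeights} {t : ℂ} {c : Fin 4 → ℂ}
    (hrel : ExactPlaquetteVertexRelation W t c) (ht : t ≠ 0) (h1 : W.u₁ ≠ 0) (h2 : W.u₂ ≠ 0)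
    (hv : W.v ≠ 0) : c 0 * W.u₂ * t ^ 10 + c 1 * W.w₂ * t ^ 9 + c 2 * W.u₁ + c 1 * W.w₁ * t = 0 := by
  have hA := vertexFunctional_rootFace_mul W ht c
  rw [hrel _ _ _ (by decide) (by decide), zero_mul] at hA
  have hB := vertexFunctional_ring8_mul W ht c
  rw [hrel _ _ _ rootFace_mem_ring8 isBoundaryRoot_holeRoot, zero_mul, ← hA, zero_mul, zero_add] at hB
  have hne : W.u₁ ^ 2 * W.u₂ ^ 2 * W.v ^ 3 ≠ 0 :=
    mul_ne_zero (mul_ne_zero (pow_ne_zero 2 h1) (pow_ne_zero 2 h2)) (pow_ne_zero 3 hv)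
  exact (mul_eq_zero.1 hB.symm).resolve_left hne

/-- **On the odd curve the loop form is `2 r t⁵ v`**: `u₂ t¹⁰ + r (w₂ t⁹ + w₁ t) − u₁ = 2 r t⁵ v` for
`W = ybCurve (−1) t r` (a rational-function identity; in the factorised closed forms
`u₁ = rt(1−t⁸)(t²−r²)/Q`, `u₂ = rt(1−t⁸)(1−t²r²)/Q`, `v = t⁴(t²−r²)(1−t²r²)/Q`, `w₁ = (t²−r²)(1−t¹⁰r²)/Q`,
`w₂ = (1−t²r²)(t¹⁰−r²)/Q`, `Q = t⁶(1+r⁴) − (1+t¹²)r²`). [cite: Glazman2015WeightedSAW, Lemma 3.1, (3.3)–(3.7)] -/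
theorem loopForm_ybCurve {t r : ℂ} (ht : t ≠ 0) (ht4 : t ^ 4 ≠ 1) (hr : r ≠ 0)
    (hD : t ^ 6 * (1 + r ^ 4) - (1 + t ^ 12) * r ^ 2 ≠ 0) :
    (ybCurve (-1) t r).u₂ * t ^ 10 + r * ((ybCurve (-1) t r).w₂ * t ^ 9 + (ybCurve (-1) t r).w₁ * t)
      - (ybCurve (-1) t r).u₁ = 2 * r * t ^ 5 * (ybCurve (-1) t r).v := by
  have ht4' : t ^ 4 - 1 ≠ 0 := fun h => ht4 (by linear_combination h)
  have hD' : t ^ 6 * (1 + r ^ 4) - r ^ 2 * (1 + t ^ 12) ≠ 0 := fun h => hD (by linear_combination h)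
  simp only [ybCurve, ybU1, ybU2, ybV, ybW1, ybW2]
  field_simp
  ring

/-- `t¹⁶ = −1 ⇒ t⁴ ≠ 1`. [folklore] -/
private theorem pow_four_ne_one_of_pow_sixteen' {t : ℂ} (h : t ^ 16 = -1) : t ^ 4 ≠ 1 := by
  intro h4
  have : t ^ 16 = 1 := by
    calc t ^ 16 = (t ^ 4) ^ 4 := by ring
      _ = 1 := by rw [h4]; norm_num
  rw [h] at this; norm_num at this

/-- **The all-boundary-roots class is EMPTY on the five-weight family with `u₁u₂v ≠ 0`**: no complex
plaquette weights with nonzero corner, co-corner and straight weights, at any phase `t ≠ 0`, satisfy an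
exact vertex relation with a nonzero coefficient vector at every face of every finite face list for
every boundary root (holes included). Exact identities on `ℤ²` live on the sixteen Yang–Baxter curves
and REQUIRE outer roots. [cite: GlazmanManolescu2019, Lemma 2.1 (outer boundary point)]
[cite: Glazman2015WeightedSAW, Lemma 3.1] -/
theorem not_exactPlaquetteVertexRelation_of_ne_zero {W : CWeights} {t : ℂ} {c : Fin 4 → ℂ}
    (ht : t ≠ 0) (h1 : W.u₁ ≠ 0) (h2 : W.u₂ ≠ 0) (hv : W.v ≠ 0) (hc : c ≠ 0) :
    ¬ ExactPlaquetteVertexRelation W t c := by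
  intro hrel
  have hRC : ExactPlaquetteVertexRelationRC W t c := hrel.toRC
  have h16 := t_pow_sixteen_of_exactPlaquetteVertexRelationRC hRC ht h1 h2 hv hc
  have ht4 := pow_four_ne_one_of_pow_sixteen' h16
  obtain ⟨ε, r, hε, hW, hc0, hcf⟩ := pair_rigidity hRC ht h1 h2 hv hc
  have hloop := loopForm_of_exactPlaquetteVertexRelation hrel ht h1 h2 hv
  have hc1 : c 1 = c 0 * r := by have h := congrFun hcf 1; simpa [epsCoeff] using h
  have hc2 : c 2 = c 0 * ε := by have h := congrFun hcf 2; simpa [epsCoeff] using h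
  rw [hc1, hc2] at hloop
  have key : c 0 * (W.u₂ * t ^ 10 + r * (W.w₂ * t ^ 9 + W.w₁ * t) + ε * W.u₁) = 0 := by
    linear_combination hloop
  have key2 := (mul_eq_zero.1 key).resolve_left hc0
  -- side conditions read off the closed forms
  have hr : r ≠ 0 := by
    rintro rfl; apply h1; rw [hW]; simp [ybCurve, ybU1]
  have hD : t ^ 6 * (1 + r ^ 4) - (1 + t ^ 12) * r ^ 2 ≠ 0 := by
    intro h; apply hv; rw [hW]; show ybV ε t r = 0; rw [ybV, h, div_zero]
  have hid := loopForm_ybCurve ht ht4 hr hD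
  rcases hε with rfl | rfl
  · -- even component: the sign gauge of the odd curve point
    rw [hW, ybCurve_one_eq_gauge] at key2 hv
    simp only [signGauge] at key2 hv
    have hv' : (ybCurve (-1) t r).v ≠ 0 := fun h => hv (by rw [h, neg_zero])
    have hz : 2 * r * t ^ 5 * (ybCurve (-1) t r).v = 0 := by rw [← hid]; linear_combination key2
    exact (mul_ne_zero (mul_ne_zero (mul_ne_zero two_ne_zero hr) (pow_ne_zero 5 ht)) hv') hz
  · rw [hW] at key2 hv
    have hz : 2 * r * t ^ 5 * (ybCurve (-1) t r).v = 0 := by rw [← hid]; linear_combination key2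
    exact (mul_ne_zero (mul_ne_zero (mul_ne_zero two_ne_zero hr) (pow_ne_zero 5 ht)) hv) hz

/-- **Barrier `PlaquetteWalkNoAllRootsRelation`** (named statement): the all-boundary-roots technique
class `ExactPlaquetteVertexRelation` is EMPTY on the five-weight family with `u₁u₂v ≠ 0` (any phase,
any nonzero coefficient vector). A THEOREM of this file (`PlaquetteWalkNoAllRootsRelation_holds`), not a
cited claim.

BARRIER (structured block, D-0021):
- technique_class: plaquette-local linear vertex relations `Σ_{s ∈ (E,N,W,S)} c_s F(z_s) = 0` with a constant coefficient vector `c ∈ ℂ⁴ ∖ {0}` for the Glazman–Manolescu plaquette walk on `ℤ²` with complex weights `(u₁, u₂, v, w₁, w₂)`, `u₁u₂v ≠ 0`, and phase `t ≠ 0` per left quarter turn, demanded at EVERY face of EVERY finite face list for EVERY boundary root — hole roots included — i.e. exactly the predicate `ExactPlaquetteVertexRelation W t c` of `PlaquetteWalkSpinRigidity`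
- blocks: an exact all-roots vertex identity for any such weights; in particular nothing is said about identities demanded at OUTER roots only — these EXIST, on the sixteen complexified Yang–Baxter curves (`PlaquetteWalkYBCurveIdentityAllSpins`, row-convex / hole-free / outer-rooted classes) — nor about observables outside the five-weight plaquette class (multi-point observables, non-local winding weights, other lattices)
- because: an all-roots relation holds on row-convex lists, so by the tree's rigidity chain (`t_pow_sixteen_of_exactPlaquetteVertexRelationRC`, `pair_rigidity`) `t¹⁶ = −1`, `W = ybCurve ε t r`, `c = c_E·(1, r, ε, εr)`; the `3 × 3` ring rooted on its hole, at the root plaquette, minus `t⁴` times the one-plaquette instance, leaves the loop form `c_E u₂ t¹⁰ + c_N (w₂ t⁹ + w₁ t) + c_W u₁ = 0` (`loopForm_of_exactPlaquetteVertexRelation`, two kernel enumerations), which on the curve equals `2 c_E r t⁵ v_{(−1)} ≠ 0` (`loopForm_ybCurve`)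
- evasions_known: restrict the root to the OUTER boundary / the domain to hole-free or row-convex face lists (Glazman–Manolescu's Lemma 2.1 and its general-domain form `PlaquetteWalkYBIdentityOuter_holds`; print's standing hypothesis «Ω simply connected, a ∈ ∂Ω» [cite: DuminilCopinSmirnov2012, §2 and proof of Lemma 1 (arXiv p. 4)]); allow root-dependent correction terms at hole roots (the defect identity `vertexFunctional_printed_isthmus_root` of `PlaquetteWalkIsthmusRoot`)
- scope_caveats: the branches `u₁ = 0` / `u₂ = 0` / `v = 0` are excluded (Glazman's degenerate family `σ = 1` lives at `v = 0` [cite: Glazman2015WeightedSAW, Lemma 3.1 (case σ = 1, p. 6)]); the statement concerns EXACT identities with constant coefficients, not approximate or asymptotic ones; the proof uses only two face lists (the ring and the single plaquette) besides the row-convex instances behind the tree's rigidity theorems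
- status: established — `PlaquetteWalkNoAllRootsRelation_holds` (this file); in print the relation is only ever stated for simply connected domains with the root on the boundary [cite: GlazmanManolescu2019, Lemma 2.1] [cite: Glazman2015WeightedSAW, Lemma 3.1], so this negative classification inside the typed class is not located in print (venture lane label: NEW-IN-WRITING, modest — lit-2 g16, 2026-08-23)
[cite: GlazmanManolescu2019, Lemma 2.1] [cite: Glazman2015WeightedSAW, Lemma 3.1] -/
def _root_.Literature.Barriers.CriticalPhenomena.PlaquetteWalkNoAllRootsRelation : Prop :=
  ∀ (W : CWeights) (t : ℂ) (c : Fin 4 → ℂ), t ≠ 0 → W.u₁ ≠ 0 → W.u₂ ≠ 0 → W.v ≠ 0 → c ≠ 0 →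
    ¬ ExactPlaquetteVertexRelation W t c

/-- **`PlaquetteWalkNoAllRootsRelation` holds.** [cite: GlazmanManolescu2019, Lemma 2.1] -/
theorem _root_.Literature.Barriers.CriticalPhenomena.PlaquetteWalkNoAllRootsRelation_holds :
    PlaquetteWalkNoAllRootsRelation :=
  fun _ _ _ ht h1 h2 hv hc => not_exactPlaquetteVertexRelation_of_ne_zero ht h1 h2 hv hc

/-- **Named statement `PlaquetteWalkHoleRootDefect`**: there is a finite face list, a boundary root
and a face at which the printed Yang–Baxter weights (`θ = π/3`) with the Yang–Baxter coefficients
violate the exact vertex relation — the OUTER-root hypothesis of Lemma 2.1 on general domains cannot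
be dropped. [cite: GlazmanManolescu2019, Lemma 2.1] -/
def _root_.Literature.Barriers.CriticalPhenomena.PlaquetteWalkHoleRootDefect : Prop :=
  ∃ (Dl : List Face) (a : MidEdge) (f₀ : Face), f₀ ∈ Dl ∧ IsBoundaryRoot Dl a ∧
    vertexFunctional (printedWeights (π / 3)) tFiveEighths (ybCoeff (π / 3)) Dl a f₀ ≠ 0

/-- **`PlaquetteWalkHoleRootDefect` holds** (witness: the ring, its hole root, the root plaquette).
[cite: GlazmanManolescu2019, Lemma 2.1] -/
theorem _root_.Literature.Barriers.CriticalPhenomena.PlaquetteWalkHoleRootDefect_holds :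
    PlaquetteWalkHoleRootDefect :=
  ⟨ring8, holeRoot, (1, 2), rootFace_mem_ring8, isBoundaryRoot_holeRoot, vertexFunctional_printed_ring8_ne_zero⟩

end Literature.Barriers.CriticalPhenomena.PlaquetteWalk
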